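import Mathlib.Topology.Maps.Proper.CompactlyGenerated
import Literature.Topology.FourManifolds.GluckTwistProofs
import Literature.Topology.FourManifolds.GluckTwistFacts
import Literature.Topology.FourManifolds.GluingConstruction
import Literature.Topology.FourManifolds.SmoothEmbeddingCriteria
import HarnessLib

/-!
# Existence of the Gluck twist along a tubular neighbourhood (Gluck 1962, §§8, 17)

Sibling proof file of `Literature.Topology.FourManifolds.GluckTwist` (D-0014: named facts
`def X : Prop` are discharged by theorems next to them). It concerns the named fact

* `Literature.Topology.FourManifolds.exists_isGluckTwist` — for every smooth 2-knot `K : S² ↪ S⁴` there is a closed (compact,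
  Hausdorff, second countable) smooth 4-manifold which is a Gluck twist of `S⁴` along `K`
  (Gluck, *The embedding of two-spheres in the four-sphere*, Trans. AMS 104 (1962), §8: the
  diffeomorphism `τ (x, θ) = (rot_θ x, θ)` of `S² × S¹`; §17: the homotopy 4-spheres obtained by
  removing a tubular neighbourhood `S² × D²` of a knotted 2-sphere from `S⁴` and sewing it back
  by `τ`; Gompf–Stipsicz, *4-Manifolds and Kirby Calculus* (1999), §6.2),

and proves everything in it except the existence of a tubular neighbourhood of the knot:

* `Literature.contMDiffOn_gluckMap_holds : contMDiffOn_gluckMap` — discharge of the named fact of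
  `GluckTwist.lean`: the radially extended Gluck map `(x, w) ↦ (rot_{w/‖w‖} x, w)` is smooth on
  `S² × (ℝ² ∖ 0)`; with its inverse `Literature.Topology.FourManifolds.gluckMapInv` (rotate back by the conjugate unit vector,
  `Literature.Topology.FourManifolds.conjCircle`) and `Literature.Topology.FourManifolds.contMDiffOn_gluckMapInv`.
* `Literature.TwoKnot.TubularNbhd.glue ν`, `.glueData ν`: for a tubular neighbourhood
  `ν : S² × ℝ² ↪ S⁴` of `K`, the gluing partial diffeomorphism `ν q ↦ gluckMapInv q` from the
  punctured tube `ν (S² × (ℝ² ∖ 0)) ⊆ S⁴ ∖ K(S²)` onto `S² × (ℝ² ∖ 0) ⊆ S² × ℝ²`, whose graph is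
  exactly the Gluck relation `Literature.gluckRel ν` (`gluckRel_iff`) and is closed (`isClosed_graph`,
  via the proper "polar" parametrisation `(x, u, t) ↦ (ν (rot_u x, t • u), (x, t • u))` in which
  the Gluck map extends continuously across the zero section).
* `Literature.TwoKnot.TubularNbhd.GluckTwist ν`: the pushout `(S⁴ ∖ K(S²)) ∪_glue (S² × ℝ²)`
  (`Literature.Topology.FourManifolds.SmoothGlueData.Glued` of `GluingConstruction.lean`), a smooth 4-manifold charted on `ℝ⁴`,
  Hausdorff (closed graph), a Gluck twist of `S⁴` along `K` (`isGluckTwist_gluckTwist`), hence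
  compact (`Literature.Topology.FourManifolds.IsGluckTwist.compactSpace_holds` of `GluckTwistProofs.lean`) and second countable.
* `Literature.TwoKnot.TubularNbhd.exists_isGluckTwist ν`: the conclusion of `exists_isGluckTwist` for a
  knot with a given tubular neighbourhood; `Literature.exists_isGluckTwist_of_nonempty_tubularNbhd :
  TwoKnot.nonempty_tubularNbhd → exists_isGluckTwist` and the converse, so that
  `Literature.exists_isGluckTwist_iff_nonempty_tubularNbhd : exists_isGluckTwist ↔
  TwoKnot.nonempty_tubularNbhd`; the same for the route-facing copy `Literature.Topology.FourManifolds.gluck_exists` of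
  `GluckTwistFacts.lean` (`gluck_exists_iff_exists_isGluckTwist`).

## What remains for `exists_isGluckTwist_holds`

Since `Literature.IsGluckTwist IX X K` records a tubular neighbourhood of `K`, the fact
`exists_isGluckTwist` is *equivalent* to the named fact `Literature.Topology.FourManifolds.TwoKnot.nonempty_tubularNbhd` of
`GluckTwist.lean`: every smooth 2-knot `S² ↪ S⁴` has a trivialised tubular neighbourhood
`S² × ℝ² ↪ S⁴` (tubular neighbourhood theorem, Hirsch, *Differential Topology* (1976), Ch. 4 §5,
Thm. 5.2, plus triviality of the normal bundle of an embedded 2-sphere in `S⁴`: an oriented plane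
bundle over `S²` with Euler number the self-intersection number `K · K = 0`; Gluck 1962, §6).
Neither the tubular neighbourhood theorem nor normal bundles/Euler numbers are in Mathlib; that
fact is left as the single open leaf, and `exists_isGluckTwist_holds` is
`exists_isGluckTwist_of_nonempty_tubularNbhd TwoKnot.nonempty_tubularNbhd_holds` once it is
discharged.

## References

* H. Gluck, *The embedding of two-spheres in the four-sphere*, Trans. Amer. Math. Soc. 104 (1962),
  308–333, §§6, 8, 17 [GluckTAMS1962].
* R. Gompf, A. Stipsicz, *4-Manifolds and Kirby Calculus*, Grad. Stud. Math. 20 (1999), §6.2.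
* *Doubles of Gluck twists: a five-dimensional approach*, arXiv:2307.06388 (Adv. Math. 2025),
  Definition 2.1 (a present-day statement of Gluck's construction, read for corroboration).
* A. Kosinski, *Differential Manifolds* (1993), Ch. VI §1 (gluing along open subsets; Hausdorff
  criterion) [Kosinski1993].

## Design notes

* The model of the glued-in piece is the open one of `GluckTwist.lean`, `S² × ℝ²` glued along
  `S² × (ℝ² ∖ 0)`, so both pieces are boundaryless and `Literature.Topology.FourManifolds.SmoothGlueData` applies verbatim, as
  for connected sums (`ConnectedSumExistence.lean`) and circle surgery
  (`CircleSurgeryExistence.lean`), on which this file is modelled.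
* Mathlib registers no `Nonempty` instance for round spheres; `instNonemptySphereTwoProdPlane`
  (for `S² × ℝ²`) is needed to invert the open embedding `ν` as an `OpenPartialHomeomorph`.
* No declaration in this file uses `sorry`.
-/

open scoped Manifold ContDiff Topology
open Function Set Metric

noncomputable section

namespace Literature.Topology.FourManifolds

/-- Local notation: `𝔼 n` is the model Euclidean space `EuclideanSpace ℝ (Fin n)`. -/
local notation "𝔼 " n:arg => EuclideanSpace ℝ (Fin n)

/-- Local notation: `𝕊 n` is the unit sphere in `EuclideanSpace ℝ (Fin (n + 1))`. -/
local notation "𝕊 " n:arg => (Metric.sphere (0 : EuclideanSpace ℝ (Fin (n + 1))) 1)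

/-! ### The conjugation of the circle and the inverse rotation -/

section Circle

/-- Complex conjugation `(c, s) ↦ (c, -s)` of the unit circle `𝕊 1 ⊆ ℝ²` (the inverse in the
circle group), packaged on `Literature.Topology.FourManifolds.conj_mem_sphere`. [folklore] -/
def conjCircle (u : 𝕊 1) : 𝕊 1 := ⟨_, conj_mem_sphere u⟩

/-- Coordinates of the conjugate: first coordinate. [folklore] -/
@[simp] theorem conjCircle_apply_zero (u : 𝕊 1) : (conjCircle u : 𝔼 2) 0 = (u : 𝔼 2) 0 := rfl

/-- Coordinates of the conjugate: second coordinate. [folklore] -/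
@[simp] theorem conjCircle_apply_one (u : 𝕊 1) : (conjCircle u : 𝔼 2) 1 = -(u : 𝔼 2) 1 := rfl

/-- Conjugation is an involution. [folklore] -/
@[simp] theorem conjCircle_conjCircle (u : 𝕊 1) : conjCircle (conjCircle u) = u := by
  apply Subtype.ext
  ext i
  fin_cases i <;> simp

/-- Rotating back: `rot_{ū} (rot_u x) = x`. [folklore] -/
@[simp] theorem rotateSphereTwo_conjCircle_rotateSphereTwo (u : 𝕊 1) (x : 𝕊 2) :
    rotateSphereTwo (conjCircle u) (rotateSphereTwo u x) = x :=
  rotateSphereTwo_conj_rotateSphereTwo u x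

/-- Rotating forth: `rot_u (rot_{ū} x) = x`. [folklore] -/
@[simp] theorem rotateSphereTwo_rotateSphereTwo_conjCircle (u : 𝕊 1) (x : 𝕊 2) :
    rotateSphereTwo u (rotateSphereTwo (conjCircle u) x) = x := by
  have h := rotateSphereTwo_conjCircle_rotateSphereTwo (conjCircle u) x
  rwa [conjCircle_conjCircle] at h

/-- The linear map `(v₀, v₁) ↦ (v₀, -v₁)` of `ℝ²` restricting to `conjCircle` (auxiliary, for
smoothness). [folklore] -/
def conjCircleAux (v : 𝔼 2) : 𝔼 2 := WithLp.toLp 2 ![v 0, -v 1]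

/-- The auxiliary conjugation map is `C^∞`. [folklore] -/
theorem contDiff_conjCircleAux : ContDiff ℝ ∞ conjCircleAux := by
  unfold conjCircleAux
  apply PiLp.contDiff_toLp.comp
  rw [contDiff_pi]
  intro i
  fin_cases i <;> simp <;> fun_prop

/-- `conjCircle` is the restriction of `conjCircleAux`. [folklore] -/
theorem coe_conjCircle (u : 𝕊 1) : (conjCircle u : 𝔼 2) = conjCircleAux (u : 𝔼 2) := rfl

/-- Conjugation of the circle is `C^∞`. [folklore] -/
theorem contMDiff_conjCircle : ContMDiff (𝓡 1) (𝓡 1) ∞ conjCircle := by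
  haveI := Fact.mk (@finrank_euclideanSpace_fin ℝ _ (1 + 1))
  have h : ContMDiff (𝓡 1) 𝓘(ℝ, 𝔼 2) ∞ (fun u : 𝕊 1 ↦ (conjCircle u : 𝔼 2)) :=
    contDiff_conjCircleAux.contMDiff.comp contMDiff_coe_sphere
  exact h.codRestrict_sphere fun u ↦ (conjCircle u).2

/-- Conjugation of the circle is continuous. [folklore] -/
theorem continuous_conjCircle : Continuous conjCircle := contMDiff_conjCircle.continuous

end Circle

/-! ### The unit vector map is smooth off the origin -/

section UnitVector

/-- The unit vector map `w ↦ w / ‖w‖ : ℝ² → 𝕊 1` extended by the junk value `(1, 0)` at the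
origin (total version of `Literature.Topology.FourManifolds.unitVector`). [folklore] -/
def unitVector₀ (w : 𝔼 2) : 𝕊 1 := if h : w = 0 then circlePoint 0 else unitVector w h

/-- Off the origin `unitVector₀` is `unitVector`. [folklore] -/
theorem unitVector₀_of_ne_zero {w : 𝔼 2} (hw : w ≠ 0) : unitVector₀ w = unitVector w hw :=
  dif_neg hw

/-- **The unit vector map is smooth off the origin** (`w ↦ w / ‖w‖` is smooth on `ℝ² ∖ 0` with
values in the circle, an embedded submanifold). [folklore] -/
theorem contMDiffOn_unitVector₀ : ContMDiffOn 𝓘(ℝ, 𝔼 2) (𝓡 1) ∞ unitVector₀ {w | w ≠ 0} := by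
  haveI := Fact.mk (@finrank_euclideanSpace_fin ℝ _ (1 + 1))
  let U : TopologicalSpace.Opens (𝔼 2) := ⟨{w | w ≠ 0}, isOpen_ne⟩
  have h1 : ContMDiff 𝓘(ℝ, 𝔼 2) 𝓘(ℝ, 𝔼 2) ∞ fun w : U ↦ ‖(w : 𝔼 2)‖⁻¹ • (w : 𝔼 2) := by
    intro w
    have hw : (w : 𝔼 2) ≠ 0 := w.2
    exact (contMDiffAt_subtype_iff (f := fun w : 𝔼 2 ↦ ‖w‖⁻¹ • w)).2
      (((contDiffAt_norm ℝ hw).inv (norm_ne_zero_iff.2 hw)).smul contDiffAt_id).contMDiffAt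
  have h2 : ∀ w : U, ‖(w : 𝔼 2)‖⁻¹ • (w : 𝔼 2) ∈ sphere (0 : 𝔼 2) 1 := fun w ↦
    (unitVector (w : 𝔼 2) w.2).2
  have h3 : ContMDiff 𝓘(ℝ, 𝔼 2) (𝓡 1) ∞ (Set.codRestrict _ _ h2) := h1.codRestrict_sphere h2
  have heq : (fun w : U ↦ unitVector₀ (w : 𝔼 2)) = Set.codRestrict _ _ h2 := by
    funext w
    rw [unitVector₀_of_ne_zero w.2]
    rfl
  intro w hw
  have h4 : ContMDiffAt 𝓘(ℝ, 𝔼 2) (𝓡 1) ∞ (fun w : U ↦ unitVector₀ (w : 𝔼 2)) ⟨w, hw⟩ := by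
    rw [heq]; exact h3 _
  exact (contMDiffAt_subtype_iff.1 h4).contMDiffWithinAt

/-- Off the origin the unit vector map is continuous. [folklore] -/
theorem continuousOn_unitVector₀ : ContinuousOn unitVector₀ {w | w ≠ 0} :=
  contMDiffOn_unitVector₀.continuousOn

/-- The unit vector of `t • u`, `t > 0`, `u ∈ 𝕊 1`, is `u`. [folklore] -/
theorem unitVector₀_smul_coe {t : ℝ} (ht : 0 < t) (u : 𝕊 1) :
    unitVector₀ (t • (u : 𝔼 2)) = u := by
  have hu : (u : 𝔼 2) ≠ 0 := ne_zero_of_mem_unit_sphere u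
  rw [unitVector₀_of_ne_zero (smul_ne_zero ht.ne' hu), unitVector_smul ht _ hu, unitVector_coe]

end UnitVector

/-! ### Smoothness of the Gluck map and its inverse -/

section GluckMap

/-- Off the zero section the Gluck map is `(x, w) ↦ (rot_{unitVector₀ w} x, w)`. [folklore] -/
theorem gluckMap_eq_of_ne_zero {p : (𝕊 2) × 𝔼 2} (hp : p.2 ≠ 0) :
    gluckMap p = (rotateSphereTwo (unitVector₀ p.2) p.1, p.2) := by
  obtain ⟨x, w⟩ := p
  rw [gluckMap_apply_of_ne_zero x hp, unitVector₀_of_ne_zero hp]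

/-- **Smoothness of the Gluck map** off the zero section: discharge of the named fact
`Literature.Topology.FourManifolds.contMDiffOn_gluckMap` (Gluck, Trans. AMS 104 (1962), §8: `τ` is a diffeomorphism of
`S² × S¹`; here its radial extension `(x, w) ↦ (rot_{w/‖w‖} x, w)` is the composite of the smooth
unit vector map `contMDiffOn_unitVector₀` and the jointly smooth rotation
`contMDiff_rotateSphereTwo`). [cite: GluckTAMS1962, §8] -/
theorem contMDiffOn_gluckMap_holds : contMDiffOn_gluckMap := by
  have hu : ContMDiffOn ((𝓡 2).prod 𝓘(ℝ, 𝔼 2)) (𝓡 1) ∞ (fun p : (𝕊 2) × 𝔼 2 ↦ unitVector₀ p.2)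
      {p | p.2 ≠ 0} :=
    contMDiffOn_unitVector₀.comp contMDiff_snd.contMDiffOn fun _ hp ↦ hp
  have hg : ContMDiffOn ((𝓡 2).prod 𝓘(ℝ, 𝔼 2)) ((𝓡 2).prod 𝓘(ℝ, 𝔼 2)) ∞
      (fun p : (𝕊 2) × 𝔼 2 ↦ (rotateSphereTwo (unitVector₀ p.2) p.1, p.2)) {p | p.2 ≠ 0} :=
    (contMDiff_rotateSphereTwo.comp_contMDiffOn (hu.prodMk contMDiff_fst.contMDiffOn)).prodMk
      contMDiff_snd.contMDiffOn
  exact hg.congr fun p hp ↦ gluckMap_eq_of_ne_zero hp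

/-- The **inverse Gluck map** `(x, w) ↦ (rot_{w̄/‖w‖} x, w)` (rotate back by the conjugate unit
vector); junk value the identity on the zero section, as for `gluckMap`. [folklore] -/
def gluckMapInv (p : (𝕊 2) × 𝔼 2) : (𝕊 2) × 𝔼 2 :=
  if h : p.2 = 0 then p else (rotateSphereTwo (conjCircle (unitVector p.2 h)) p.1, p.2)

/-- The inverse Gluck map preserves the second coordinate. [folklore] -/
@[simp] theorem gluckMapInv_snd (p : (𝕊 2) × 𝔼 2) : (gluckMapInv p).2 = p.2 := by
  unfold gluckMapInv
  split_ifs <;> rfl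

/-- Off the zero section the inverse Gluck map is `(x, w) ↦ (rot_{conj (unitVector₀ w)} x, w)`.
[folklore] -/
theorem gluckMapInv_eq_of_ne_zero {p : (𝕊 2) × 𝔼 2} (hp : p.2 ≠ 0) :
    gluckMapInv p = (rotateSphereTwo (conjCircle (unitVector₀ p.2)) p.1, p.2) := by
  obtain ⟨x, w⟩ := p
  simp only at hp
  rw [gluckMapInv, dif_neg hp, unitVector₀_of_ne_zero hp]

/-- `gluckMapInv ∘ gluckMap = id` off the zero section. [folklore] -/
theorem gluckMapInv_gluckMap {p : (𝕊 2) × 𝔼 2} (hp : p.2 ≠ 0) : gluckMapInv (gluckMap p) = p := by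
  have hp' : (gluckMap p).2 ≠ 0 := by rwa [gluckMap_snd]
  rw [gluckMapInv_eq_of_ne_zero hp', gluckMap_eq_of_ne_zero hp]
  simp

/-- `gluckMap ∘ gluckMapInv = id` off the zero section. [folklore] -/
theorem gluckMap_gluckMapInv {p : (𝕊 2) × 𝔼 2} (hp : p.2 ≠ 0) : gluckMap (gluckMapInv p) = p := by
  have hp' : (gluckMapInv p).2 ≠ 0 := by rwa [gluckMapInv_snd]
  rw [gluckMap_eq_of_ne_zero hp', gluckMapInv_eq_of_ne_zero hp]
  simp

/-- The inverse Gluck map maps the complement of the zero section to itself. [folklore] -/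
theorem mapsTo_gluckMapInv :
    MapsTo gluckMapInv {p : (𝕊 2) × 𝔼 2 | p.2 ≠ 0} {p : (𝕊 2) × 𝔼 2 | p.2 ≠ 0} := by
  intro p hp
  simpa using hp

/-- **Smoothness of the inverse Gluck map** off the zero section. [folklore] -/
theorem contMDiffOn_gluckMapInv :
    ContMDiffOn ((𝓡 2).prod 𝓘(ℝ, 𝔼 2)) ((𝓡 2).prod 𝓘(ℝ, 𝔼 2)) ∞ gluckMapInv
      {p : (𝕊 2) × 𝔼 2 | p.2 ≠ 0} := by
  have hu : ContMDiffOn ((𝓡 2).prod 𝓘(ℝ, 𝔼 2)) (𝓡 1) ∞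
      (fun p : (𝕊 2) × 𝔼 2 ↦ conjCircle (unitVector₀ p.2)) {p | p.2 ≠ 0} :=
    contMDiff_conjCircle.comp_contMDiffOn
      (contMDiffOn_unitVector₀.comp contMDiff_snd.contMDiffOn fun _ hp ↦ hp)
  have hg : ContMDiffOn ((𝓡 2).prod 𝓘(ℝ, 𝔼 2)) ((𝓡 2).prod 𝓘(ℝ, 𝔼 2)) ∞
      (fun p : (𝕊 2) × 𝔼 2 ↦ (rotateSphereTwo (conjCircle (unitVector₀ p.2)) p.1, p.2))
      {p | p.2 ≠ 0} :=
    (contMDiff_rotateSphereTwo.comp_contMDiffOn (hu.prodMk contMDiff_fst.contMDiffOn)).prodMk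
      contMDiff_snd.contMDiffOn
  exact hg.congr fun p hp ↦ gluckMapInv_eq_of_ne_zero hp

/-- The Gluck map is continuous off the zero section. [folklore] -/
theorem continuousOn_gluckMap : ContinuousOn gluckMap {p : (𝕊 2) × 𝔼 2 | p.2 ≠ 0} :=
  contMDiffOn_gluckMap_holds.continuousOn

/-- The inverse Gluck map is continuous off the zero section. [folklore] -/
theorem continuousOn_gluckMapInv : ContinuousOn gluckMapInv {p : (𝕊 2) × 𝔼 2 | p.2 ≠ 0} :=
  contMDiffOn_gluckMapInv.continuousOn

end GluckMap

/-! ### The gluing datum of the Gluck twist along a tubular neighbourhood -/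

section Datum

namespace TwoKnot.TubularNbhd

variable {K : TwoKnot} (ν : TwoKnot.TubularNbhd K)

/-- A tubular neighbourhood map `ν : 𝕊 2 × ℝ² → 𝕊 4` is an open embedding (smooth embedding of
`4`-manifolds, `TwoKnot.TubularNbhd.isOpen_range`). [folklore] -/
protected theorem isOpenEmbedding : Topology.IsOpenEmbedding ν.toFun :=
  ⟨ν.isSmoothEmbedding.isEmbedding, ν.isOpen_range⟩

/-- `𝕊 2 × ℝ²` is nonempty (Mathlib registers no `Nonempty` instance for round spheres; needed to
invert the open embedding `ν` as a partial homeomorphism). [folklore] -/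
instance instNonemptySphereTwoProdPlane : Nonempty ((𝕊 2) × 𝔼 2) :=
  ⟨(⟨EuclideanSpace.single 0 1, by simp⟩, 0)⟩

/-- The tubular neighbourhood as an open partial homeomorphism `𝕊 2 × ℝ² ⇀ 𝕊 4` (source `univ`,
target `range ν`). [folklore] -/
def toHomeo : OpenPartialHomeomorph ((𝕊 2) × 𝔼 2) (𝕊 4) :=
  ν.isOpenEmbedding.toOpenPartialHomeomorph _

/-- The partial homeomorphism of `ν` is `ν` as a function. [folklore] -/
@[simp] theorem toHomeo_apply (q : (𝕊 2) × 𝔼 2) : ν.toHomeo q = ν.toFun q := rfl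

/-- The partial homeomorphism of `ν` is defined everywhere. [folklore] -/
@[simp] theorem toHomeo_source : ν.toHomeo.source = univ := by simp [toHomeo]

/-- The target of the partial homeomorphism of `ν` is the range of `ν`. [folklore] -/
@[simp] theorem toHomeo_target : ν.toHomeo.target = range ν.toFun := by simp [toHomeo]

/-- The inverse partial homeomorphism is a left inverse of `ν`. [folklore] -/
@[simp] theorem toHomeo_symm_apply (q : (𝕊 2) × 𝔼 2) : ν.toHomeo.symm (ν.toFun q) = q :=
  ν.isOpenEmbedding.toOpenPartialHomeomorph_left_inv

/-- **The inverse of a tubular neighbourhood map is smooth on its range** (inverse function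
theorem for the open smooth embedding `ν`, `Literature.Topology.FourManifolds.contMDiffOn_symm_of_isSmoothEmbedding`).
[folklore] -/
theorem contMDiffOn_toHomeo_symm :
    ContMDiffOn (𝓡 4) ((𝓡 2).prod 𝓘(ℝ, 𝔼 2)) ∞ ν.toHomeo.symm (range ν.toFun) :=
  contMDiffOn_symm_of_isSmoothEmbedding ν.isSmoothEmbedding ν.isOpenEmbedding

/-- `ν (x, w)` lies on the knot iff `w = 0`. [folklore] -/
theorem apply_mem_range_iff {x : 𝕊 2} {w : 𝔼 2} : ν.toFun (x, w) ∈ range K ↔ w = 0 := by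
  constructor
  · intro h
    by_contra hw
    exact ν.apply_mem_compl_range x hw h
  · rintro rfl
    exact ⟨x, (ν.apply_zero x).symm⟩

/-! #### The punctured tube and the gluing maps -/

/-- The **punctured tube** `ν (𝕊 2 × (ℝ² ∖ 0))`, the gluing region on the side of the knot
complement. [folklore] -/
def puncturedTube : Set (𝕊 4) := ν.toFun '' {q | q.2 ≠ 0}

/-- The punctured tube is open (`ν` is an open map). [folklore] -/
theorem isOpen_puncturedTube : IsOpen ν.puncturedTube :=
  ν.isOpen_image (isOpen_ne.preimage continuous_snd)

/-- The punctured tube lies in the range of `ν`. [folklore] -/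
theorem puncturedTube_subset_range : ν.puncturedTube ⊆ range ν.toFun := image_subset_range _ _

/-- `ν q` lies in the punctured tube iff `q` is off the zero section. [folklore] -/
theorem apply_mem_puncturedTube_iff {q : (𝕊 2) × 𝔼 2} : ν.toFun q ∈ ν.puncturedTube ↔ q.2 ≠ 0 :=
  ν.injective.mem_set_image

/-- The punctured tube misses the knot. [folklore] -/
theorem puncturedTube_subset_compl_range : ν.puncturedTube ⊆ (range K)ᶜ := by
  rintro _ ⟨⟨x, w⟩, hw, rfl⟩
  exact ν.apply_mem_compl_range x hw

/-- The forward gluing map at the level of `𝕊 4`: `gluckMapInv ∘ ν⁻¹` (junk off `range ν`).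
[folklore] -/
def fwd (a : 𝕊 4) : (𝕊 2) × 𝔼 2 := gluckMapInv (ν.toHomeo.symm a)

/-- On the range of `ν` the forward map is `gluckMapInv ∘ ν⁻¹`. [folklore] -/
theorem fwd_apply (q : (𝕊 2) × 𝔼 2) : ν.fwd (ν.toFun q) = gluckMapInv q := by
  rw [fwd, toHomeo_symm_apply]

/-- The forward map `gluckMapInv ∘ ν⁻¹` is smooth on the punctured tube. [folklore] -/
theorem contMDiffOn_fwd : ContMDiffOn (𝓡 4) ((𝓡 2).prod 𝓘(ℝ, 𝔼 2)) ∞ ν.fwd ν.puncturedTube := by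
  refine contMDiffOn_gluckMapInv.comp (ν.contMDiffOn_toHomeo_symm.mono ν.puncturedTube_subset_range)
    ?_
  rintro _ ⟨q, hq, rfl⟩
  simpa only [mem_preimage, toHomeo_symm_apply] using hq

/-- A fixed nonzero vector `e₀ ∈ ℝ²`. [folklore] -/
def unitVec₀ : 𝔼 2 := EuclideanSpace.single 0 1

/-- `e₀ ≠ 0`. [folklore] -/
theorem unitVec₀_ne_zero : unitVec₀ ≠ 0 := by
  simp [unitVec₀]

/-- A base point of the knot complement (junk value): `ν (p, e₀)`. [folklore] -/
def basePt : K.complement :=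
  ⟨ν.toFun (⟨EuclideanSpace.single 0 1, by simp⟩, unitVec₀),
    ν.apply_mem_compl_range _ unitVec₀_ne_zero⟩

/-- `ν (gluckMap b)` lies in the knot complement for `b` off the zero section. [folklore] -/
theorem apply_gluckMap_mem_complement {b : (𝕊 2) × 𝔼 2} (hb : b.2 ≠ 0) :
    ν.toFun (gluckMap b) ∈ K.complement := by
  rw [SphereEmbedding.mem_complement_iff]
  have hb' : (gluckMap b).2 ≠ 0 := by rwa [gluckMap_snd]
  exact ν.apply_mem_compl_range (gluckMap b).1 hb'

/-- The backward gluing map `𝕊 2 × ℝ² → 𝕊 4 ∖ K(𝕊 2)`, `b ↦ ν (gluckMap b)` off the zero section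
(junk value `basePt` on it). [folklore] -/
def bwd (b : (𝕊 2) × 𝔼 2) : K.complement := by
  classical
  exact if h : b.2 ≠ 0 then ⟨ν.toFun (gluckMap b), ν.apply_gluckMap_mem_complement h⟩ else ν.basePt

/-- Off the zero section the backward map is `ν ∘ gluckMap`. [folklore] -/
theorem coe_bwd_apply {b : (𝕊 2) × 𝔼 2} (hb : b.2 ≠ 0) :
    (ν.bwd b : 𝕊 4) = ν.toFun (gluckMap b) := by
  rw [bwd, dif_pos hb]

/-- The backward map `ν ∘ gluckMap` is smooth off the zero section (as a map into the open
submanifold `𝕊 4 ∖ K(𝕊 2)`). [folklore] -/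
theorem contMDiffOn_bwd :
    ContMDiffOn ((𝓡 2).prod 𝓘(ℝ, 𝔼 2)) (𝓡 4) ∞ ν.bwd {b : (𝕊 2) × 𝔼 2 | b.2 ≠ 0} := by
  have ho : IsOpen {b : (𝕊 2) × 𝔼 2 | b.2 ≠ 0} := isOpen_ne.preimage continuous_snd
  have hX : ContMDiffOn ((𝓡 2).prod 𝓘(ℝ, 𝔼 2)) (𝓡 4) ∞ (fun b ↦ ν.toFun (gluckMap b))
      {b : (𝕊 2) × 𝔼 2 | b.2 ≠ 0} :=
    ν.contMDiff.comp_contMDiffOn contMDiffOn_gluckMap_holds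
  intro b hb
  refine ContMDiffAt.contMDiffWithinAt ?_
  rw [← ContMDiffAt.subtypeVal_comp_iff]
  have hev : (Subtype.val ∘ ν.bwd) =ᶠ[𝓝 b] fun b ↦ ν.toFun (gluckMap b) := by
    filter_upwards [ho.mem_nhds hb] with p hp
    exact ν.coe_bwd_apply hp
  exact (hX.contMDiffAt (ho.mem_nhds hb)).congr_of_eventuallyEq hev

/-- **The gluing partial diffeomorphism of the Gluck twist** along `ν`:
`ν (q) ↦ gluckMapInv q` from the punctured tube `ν (𝕊 2 × (ℝ² ∖ 0)) ⊆ 𝕊 4 ∖ K(𝕊 2)` onto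
`𝕊 2 × (ℝ² ∖ 0) ⊆ 𝕊 2 × ℝ²`, with inverse `b ↦ ν (gluckMap b)`: the point `ν (rot_{w/‖w‖} x, w)`
of the knot complement is identified with `(x, w)` (Gluck, Trans. AMS 104 (1962), §8;
Gompf–Stipsicz, *4-Manifolds and Kirby Calculus*, §6.2). [folklore] -/
def glue : OpenPartialHomeomorph K.complement ((𝕊 2) × 𝔼 2) where
  toFun a := ν.fwd a
  invFun b := ν.bwd b
  source := {a | (a : 𝕊 4) ∈ ν.puncturedTube}
  target := {b | b.2 ≠ 0}
  map_source' := by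
    rintro ⟨_, ha⟩ ⟨q, hq, rfl⟩
    show (ν.fwd (ν.toFun q)).2 ≠ 0
    rwa [fwd_apply, gluckMapInv_snd]
  map_target' := by
    intro b hb
    show (ν.bwd b : 𝕊 4) ∈ ν.puncturedTube
    rw [ν.coe_bwd_apply hb, apply_mem_puncturedTube_iff, gluckMap_snd]
    exact hb
  left_inv' := by
    rintro ⟨_, ha⟩ ⟨q, hq, rfl⟩
    apply Subtype.ext
    have hq' : (gluckMapInv q).2 ≠ 0 := by rwa [gluckMapInv_snd]
    show (ν.bwd (ν.fwd (ν.toFun q)) : 𝕊 4) = ν.toFun q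
    rw [fwd_apply, ν.coe_bwd_apply hq', gluckMap_gluckMapInv hq]
  right_inv' := by
    intro b hb
    show ν.fwd (ν.bwd b) = b
    rw [fwd, ν.coe_bwd_apply hb, toHomeo_symm_apply, gluckMapInv_gluckMap hb]
  open_source := ν.isOpen_puncturedTube.preimage continuous_subtype_val
  open_target := isOpen_ne.preimage continuous_snd
  continuousOn_toFun :=
    (ν.contMDiffOn_fwd.comp contMDiff_subtype_val.contMDiffOn fun _ ha ↦ ha).continuousOn
  continuousOn_invFun := ν.contMDiffOn_bwd.continuousOn

/-- The source of the gluing map is the punctured tube. [folklore] -/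
theorem glue_source : ν.glue.source = {a : K.complement | (a : 𝕊 4) ∈ ν.puncturedTube} := rfl

/-- The target of the gluing map is the complement of the zero section. [folklore] -/
theorem glue_target : ν.glue.target = {b : (𝕊 2) × 𝔼 2 | b.2 ≠ 0} := rfl

/-- The gluing map is the forward map. [folklore] -/
theorem glue_apply (a : K.complement) : ν.glue a = ν.fwd a := rfl

/-- The inverse gluing map is the backward map. [folklore] -/
theorem glue_symm_apply (b : (𝕊 2) × 𝔼 2) : ν.glue.symm b = ν.bwd b := rfl

/-- The gluing map is smooth on its source. [folklore] -/
theorem contMDiffOn_glue : ContMDiffOn (𝓡 4) ((𝓡 2).prod 𝓘(ℝ, 𝔼 2)) ∞ ν.glue ν.glue.source :=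
  ν.contMDiffOn_fwd.comp contMDiff_subtype_val.contMDiffOn fun _ ha ↦ ha

/-- The inverse gluing map is smooth on its source. [folklore] -/
theorem contMDiffOn_glue_symm :
    ContMDiffOn ((𝓡 2).prod 𝓘(ℝ, 𝔼 2)) (𝓡 4) ∞ ν.glue.symm ν.glue.target :=
  ν.contMDiffOn_bwd

/-- The identification `ℝ² × ℝ² ≃L ℝ⁴` of the model vector spaces (equal dimension). [folklore] -/
def linB : ((𝔼 2) × 𝔼 2) ≃L[ℝ] 𝔼 4 :=
  ContinuousLinearEquiv.ofFinrankEq (by simp)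

/-- **The gluing datum of the Gluck twist** along the tubular neighbourhood `ν`
(`Literature.Topology.FourManifolds.SmoothGlueData` of the knot complement and `𝕊 2 × ℝ²`). [folklore] -/
def glueData : SmoothGlueData (𝓡 4) ((𝓡 2).prod 𝓘(ℝ, 𝔼 2)) K.complement ((𝕊 2) × 𝔼 2) (𝔼 4) where
  glue := ν.glue
  contMDiffOn_glue := ν.contMDiffOn_glue
  contMDiffOn_glue_symm := ν.contMDiffOn_glue_symm
  linA := ContinuousLinearEquiv.refl ℝ (𝔼 4)
  linB := linB

/-- The gluing map of the datum is `ν.glue`. [folklore] -/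
@[simp] theorem glueData_glue : ν.glueData.glue = ν.glue := rfl

/-- **The gluing datum realises the Gluck relation** `gluckRel ν`: `a ∼ b` iff `a` lies in the
punctured tube and is sent to `b`. [folklore] -/
theorem gluckRel_iff (a : K.complement) (b : (𝕊 2) × 𝔼 2) :
    gluckRel ν a b ↔ a ∈ ν.glueData.glue.source ∧ ν.glueData.glue a = b := by
  change gluckRel ν a b ↔ (a : 𝕊 4) ∈ ν.puncturedTube ∧ ν.fwd a = b
  constructor
  · rintro ⟨hb, ha⟩
    have hb' : (gluckMap b).2 ≠ 0 := by rwa [gluckMap_snd]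
    refine ⟨?_, ?_⟩
    · rw [ha, apply_mem_puncturedTube_iff]
      exact hb'
    · rw [ha, fwd_apply, gluckMapInv_gluckMap hb]
  · rintro ⟨⟨q, hq, ha⟩, rfl⟩
    refine ⟨?_, ?_⟩
    · rw [← ha, fwd_apply, gluckMapInv_snd]
      exact hq
    · rw [← ha, fwd_apply, gluckMap_gluckMapInv hq]

/-! #### The graph of the gluing map is closed -/

/-- The parametrisation `(x, u, t) ↦ (ν (rot_u x, t • u), (x, t • u))` of the closure of the graph
of the gluing map by `𝕊 2 × 𝕊 1 × ℝ` ("polar coordinates" in the normal plane, in which the Gluck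
map extends continuously across the zero section). [folklore] -/
def graphParam (r : (𝕊 2) × (𝕊 1) × ℝ) : (𝕊 4) × ((𝕊 2) × 𝔼 2) :=
  (ν.toFun (rotateSphereTwo r.2.1 r.1, r.2.2 • (r.2.1 : 𝔼 2)), (r.1, r.2.2 • (r.2.1 : 𝔼 2)))

/-- The parametrisation of the graph is continuous. [folklore] -/
theorem continuous_graphParam : Continuous ν.graphParam := by
  have hν := ν.continuous
  have h1 : Continuous fun r : (𝕊 2) × (𝕊 1) × ℝ ↦ (r.2.1, r.1) :=
    (continuous_fst.comp continuous_snd).prodMk continuous_fst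
  have hrot : Continuous fun r : (𝕊 2) × (𝕊 1) × ℝ ↦ rotateSphereTwo r.2.1 r.1 :=
    contMDiff_rotateSphereTwo.continuous.comp h1
  have hsmul : Continuous fun r : (𝕊 2) × (𝕊 1) × ℝ ↦ r.2.2 • (r.2.1 : 𝔼 2) :=
    (continuous_snd.comp continuous_snd).smul
      (continuous_subtype_val.comp (continuous_fst.comp continuous_snd))
  exact (hν.comp (hrot.prodMk hsmul)).prodMk (continuous_fst.prodMk hsmul)

/-- The parametrisation of the graph is a proper map: the parameter `t` is recovered as
`±‖t • u‖`, so preimages of compact sets are closed subsets of `𝕊 2 × 𝕊 1 × [-R, R]`. [folklore] -/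
theorem isProperMap_graphParam : IsProperMap ν.graphParam := by
  rw [isProperMap_iff_isCompact_preimage]
  refine ⟨ν.continuous_graphParam, fun C hC ↦ ?_⟩
  -- the second `ℝ²`-coordinate is bounded on `C`
  obtain ⟨R, hR⟩ := (hC.image (continuous_snd.comp continuous_snd)).isBounded.exists_norm_le
  have hsub : ν.graphParam ⁻¹' C ⊆ univ ×ˢ univ ×ˢ Icc (-R) R := by
    rintro ⟨x, u, t⟩ hr
    have h := hR _ (mem_image_of_mem _ hr)
    simp only [comp_apply, graphParam, norm_smul, Real.norm_eq_abs, norm_eq_of_mem_sphere,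
      mul_one] at h
    exact ⟨mem_univ _, mem_univ _, abs_le.1 h⟩
  exact (isCompact_univ.prod (isCompact_univ.prod isCompact_Icc)).of_isClosed_subset
    (hC.isClosed.preimage ν.continuous_graphParam) hsub

/-- The image of `𝕊 2 × 𝕊 1 × [0, ∞)` under the parametrisation is closed. [folklore] -/
theorem isClosed_image_graphParam : IsClosed (ν.graphParam '' (univ ×ˢ univ ×ˢ Ici 0)) :=
  ν.isProperMap_graphParam.isClosedMap _
    (isClosed_univ.prod (isClosed_univ.prod isClosed_Ici))

/-- **The graph of the gluing map is closed** in `(𝕊 4 ∖ K(𝕊 2)) × (𝕊 2 × ℝ²)`: it is the trace of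
the closed set `graphParam (𝕊 2 × 𝕊 1 × [0, ∞))`, whose extra points (`t = 0`) have first
coordinate `ν (y, 0) = K y` on the knot, outside the complement. This is the Hausdorff condition for
the Gluck twist pushout. [folklore] -/
theorem isClosed_graph : IsClosed {p : K.complement × ((𝕊 2) × 𝔼 2) |
    p.1 ∈ ν.glueData.glue.source ∧ ν.glueData.glue p.1 = p.2} := by
  have hcont : Continuous fun p : K.complement × ((𝕊 2) × 𝔼 2) ↦ ((p.1 : 𝕊 4), p.2) := by
    fun_prop
  convert ν.isClosed_image_graphParam.preimage hcont using 1
  ext ⟨a, ⟨x, w⟩⟩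
  rw [mem_setOf_eq, ← gluckRel_iff]
  simp only [mem_preimage, mem_image, mem_prod, mem_univ, true_and, mem_Ici]
  constructor
  · rintro ⟨hw, ha⟩
    have hw' : (0 : ℝ) < ‖w‖ := norm_pos_iff.2 hw
    refine ⟨(x, unitVector₀ w, ‖w‖), norm_nonneg _, ?_⟩
    have hsmul : ‖w‖ • (unitVector₀ w : 𝔼 2) = w := by
      rw [unitVector₀_of_ne_zero hw, coe_unitVector, smul_smul, mul_inv_cancel₀ hw'.ne',
        one_smul]
    simp only [graphParam, hsmul, Prod.mk.injEq, and_true]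
    rw [ha, gluckMap_eq_of_ne_zero hw]
  · rintro ⟨⟨x', u, t⟩, ht, h⟩
    simp only [graphParam, Prod.mk.injEq] at h
    obtain ⟨ha, rfl, rfl⟩ := h
    have ht' : 0 < t := by
      rcases (ht : 0 ≤ t).lt_or_eq with h | rfl
      · exact h
      · exfalso
        refine a.2 ⟨rotateSphereTwo u x', ?_⟩
        rw [← ha, zero_smul, ν.apply_zero]
    have hw : t • (u : 𝔼 2) ≠ 0 := smul_ne_zero ht'.ne' (ne_zero_of_mem_unit_sphere u)
    refine ⟨hw, ?_⟩
    rw [gluckMap_eq_of_ne_zero hw, ← ha]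
    simp only [unitVector₀_smul_coe ht']

/-! #### The twisted sphere `Σ_K` -/

/-- **The Gluck twist of `S⁴` along `K`, built from the tubular neighbourhood `ν`**:
`Σ_K = (𝕊 4 ∖ K(𝕊 2)) ∪_glue (𝕊 2 × ℝ²)`, the glued space of the Gluck gluing datum
(Gluck, Trans. AMS 104 (1962), §§8, 17; Gompf–Stipsicz, *4-Manifolds and Kirby Calculus*,
§6.2). It is a smooth 4-manifold charted on `ℝ⁴` by the generic gluing construction
(`Literature.Topology.FourManifolds.SmoothGlueData.instChartedSpace`, `instIsManifold`). [folklore] -/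
abbrev GluckTwist : Type := ν.glueData.Glued

/-- The Gluck twist `Σ_K` is Hausdorff (closed graph of the gluing map). [folklore] -/
instance t2Space_gluckTwist : T2Space ν.GluckTwist :=
  ν.glueData.t2Space_of_isClosed_graph ν.isClosed_graph

/-- The Gluck twist `Σ_K` is an open gluing of `𝕊 4 ∖ K(𝕊 2)` and `𝕊 2 × ℝ²` along `gluckRel ν`.
[folklore] -/
theorem isOpenGluing_gluckTwist :
    IsOpenGluing (𝓡 4) ((𝓡 2).prod 𝓘(ℝ, 𝔼 2)) (𝓡 4) (A := K.complement) (B := (𝕊 2) × 𝔼 2)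
      (P := ν.GluckTwist) (gluckRel ν) :=
  ν.glueData.isOpenGluing ν.gluckRel_iff

/-- The glued space `Σ_K` **is a Gluck twist** of `S⁴` along `K` (`Literature.Topology.FourManifolds.IsGluckTwist`). [folklore] -/
theorem isGluckTwist_gluckTwist : IsGluckTwist (𝓡 4) ν.GluckTwist K :=
  ⟨ν, ν.isOpenGluing_gluckTwist⟩

/-- The Gluck twist `Σ_K` is compact (`Literature.Topology.FourManifolds.IsGluckTwist.compactSpace_holds`: it is covered by the
images of the compact pieces `𝕊 4 ∖ ν (𝕊 2 × B₁)` and `𝕊 2 × B̄₁`; Gluck 1962, §17). [folklore] -/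
instance compactSpace_gluckTwist : CompactSpace ν.GluckTwist :=
  IsGluckTwist.compactSpace_holds ν.isGluckTwist_gluckTwist

/-- The Gluck twist `Σ_K` is second countable (a compact space charted on `ℝ⁴`). [folklore] -/
instance secondCountable_gluckTwist : SecondCountableTopology ν.GluckTwist :=
  ν.glueData.secondCountableTopology

end TwoKnot.TubularNbhd

end Datum

/-! ### Existence of the Gluck twist -/

/-- **The Gluck twist along a given tubular neighbourhood exists**: for every 2-knot `K` and every
tubular neighbourhood `ν` of `K` there is a closed (compact, Hausdorff, second countable) smooth
4-manifold which is a Gluck twist of `S⁴` along `K` — the pushout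
`(𝕊 4 ∖ K(𝕊 2)) ∪_glue (𝕊 2 × ℝ²)` along `ν (rot_{w/‖w‖} x, w) ∼ (x, w)`
(Gluck, Trans. AMS 104 (1962), §8 (the twist `τ`) and §17 (the manifolds obtained by removing
a tubular neighbourhood of a knotted `S²` from `S⁴` and sewing `S² × D²` back by `τ`);
Gompf–Stipsicz (1999), §6.2). [cite: GluckTAMS1962, §§8 and 17] -/
theorem TwoKnot.TubularNbhd.exists_isGluckTwist {K : TwoKnot} (ν : TwoKnot.TubularNbhd K) :
    ∃ (X : Type) (_ : TopologicalSpace X) (_ : T2Space X) (_ : SecondCountableTopology X)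
      (_ : ChartedSpace (𝔼 4) X) (_ : IsManifold (𝓡 4) ∞ X) (_ : CompactSpace X),
      IsGluckTwist (𝓡 4) X K :=
  ⟨ν.GluckTwist, inferInstance, inferInstance, inferInstance, inferInstance, inferInstance,
    inferInstance, ν.isGluckTwist_gluckTwist⟩

/-- **Existence of the Gluck twist, reduced to the existence of tubular neighbourhoods**: the named
fact `Literature.Topology.FourManifolds.exists_isGluckTwist` (Gluck 1962, §§8, 17) follows from the named fact
`Literature.Topology.FourManifolds.TwoKnot.nonempty_tubularNbhd` (every smooth 2-knot has a trivialised tubular neighbourhood: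
tubular neighbourhood theorem, Hirsch, *Differential Topology*, Ch. 4 §5, Thm. 5.2, and triviality
of the normal bundle of an embedded `S²` in `S⁴`, Gluck 1962, §6), by the construction
`TwoKnot.TubularNbhd.exists_isGluckTwist`. [cite: GluckTAMS1962, §§8 and 17] -/
theorem exists_isGluckTwist_of_nonempty_tubularNbhd (h : TwoKnot.nonempty_tubularNbhd) :
    exists_isGluckTwist :=
  fun K ↦ (h K).elim fun ν ↦ ν.exists_isGluckTwist

/-- Conversely, the existence of Gluck twists in the sense of `Literature.Topology.FourManifolds.IsGluckTwist` (which records a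
tubular neighbourhood of the knot) entails the existence of tubular neighbourhoods: the two named
facts `exists_isGluckTwist` and `TwoKnot.nonempty_tubularNbhd` are equivalent. [folklore] -/
theorem nonempty_tubularNbhd_of_exists_isGluckTwist (h : exists_isGluckTwist) :
    TwoKnot.nonempty_tubularNbhd := by
  intro K
  obtain ⟨X, _, _, _, _, _, _, ν, -⟩ := h K
  exact ⟨ν⟩

/-- `exists_isGluckTwist ↔ TwoKnot.nonempty_tubularNbhd`: the remaining content of the existence
of Gluck twists is exactly the tubular neighbourhood theorem for 2-knots. [folklore] -/
theorem exists_isGluckTwist_iff_nonempty_tubularNbhd :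
    exists_isGluckTwist ↔ TwoKnot.nonempty_tubularNbhd :=
  ⟨nonempty_tubularNbhd_of_exists_isGluckTwist, exists_isGluckTwist_of_nonempty_tubularNbhd⟩

/-- The route-facing named fact `Literature.Topology.FourManifolds.gluck_exists` of `GluckTwistFacts.lean` is, verbatim, the fact
`Literature.Topology.FourManifolds.exists_isGluckTwist` of `GluckTwist.lean` (Gluck 1962, §§8, 17). [folklore] -/
theorem gluck_exists_iff_exists_isGluckTwist : gluck_exists ↔ exists_isGluckTwist := Iff.rfl

/-- `Literature.Topology.FourManifolds.gluck_exists` (Gluck 1962, §§8, 17: the Gluck twist exists as a closed smooth 4-manifold)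
follows from the existence of tubular neighbourhoods of 2-knots
(`Literature.Topology.FourManifolds.TwoKnot.nonempty_tubularNbhd`). [cite: GluckTAMS1962, §§8 and 17] -/
theorem gluck_exists_of_nonempty_tubularNbhd (h : TwoKnot.nonempty_tubularNbhd) : gluck_exists :=
  exists_isGluckTwist_of_nonempty_tubularNbhd h

end Literature.Topology.FourManifolds
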